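import Literature.Analysis.FluidPDE.GavrilovSteadyEulerProofs
import Literature.Analysis.FluidPDE.VorticityCalculus

/-!
# The curl and the helicity density of Gavrilov's ansatz (support of `ChiralEddyExists`)

Helper file for item `stmt-NavierStokesRegularity-10397` (`ChiralEddyExists`, route AdiabaticEddy;
lands `--supports`).  For Gavrilov's axisymmetric ansatz `U = ρ⁻¹(a_z e_ρ − a_ρ e_z + c e_φ)`
(tree: `Literature.Analysis.FluidPDE.Gavrilov.AnsatzData.U`, Gavrilov 2019 §3 (4)) we compute

* the vorticity `curl U` in Cartesian coordinates (`curl_U_apply_zero/one/two`):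
  `curl U = ρ⁻² (Δ*a) (−X₁, X₀, 0) − ρ⁻² c_z (X₀, X₁, 0) + (c_ρ/ρ) e₃`, `Δ*a = a_ρρ + a_zz − a_ρ/ρ`;
* the helicity density `⟪U, curl U⟫ = ρ⁻²(c Δ*a − a_z c_z − a_ρ c_ρ)` (`inner_U_curl_U`);
* for Gavrilov's local solution `α` (tree: `ProfileData.alpha`) the two exact identities
  `|∇α|² = 12x²α − H(α)` (`normSq_grad_alpha`) and the Grad–Shafranov form
  `Δ*α = 10x² − H'(α)/2` (`lapStar_alpha`), whence, for the ansatz at radius `1`,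
  **`⟪U, curl U⟫ = 2(5H(α) − 3αH'(α))/√H(α)`** (`inner_U_curl_U_A1`), a function of `α` alone that
  is positive near the core circle (`exists_helicityFactor_pos`: `5H − 3αH' ∼ 8α`).

These feed the proof that Gavrilov's compactly supported steady Euler flows have nonzero helicity
(the `h ≠ 0` clause of `ChiralEddyExists`).
-/

noncomputable section

set_option linter.dupNamespace false -- nested layout Summit.<S>.<Sub>, Sub = S (D-0017)

open Set Filter Function WithLp InnerProductSpace
open scoped Topology RealInnerProductSpace

namespace Summit.NavierStokesRegularity.NavierStokesRegularity.Theorems.ChiralEddyExists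

open Literature.Analysis.FluidPDE Literature.Analysis.FluidPDE.Gavrilov
  Literature.Analysis.FluidPDE.Gavrilov.AnsatzData

variable {A : AnsatzData} {X : EuclideanSpace ℝ (Fin 3)}

section pointwise

variable (hX : X ∈ A.tube)
include hX

/-- **First component of the vorticity of the ansatz**:
`(curl U)₀ = −X₁ ρ⁻² Δ*a − X₀ ρ⁻² c_z`. -/
theorem curl_U_apply_zero :
    curl A.U X 0 = -(X 1 * (cylRadius X)⁻¹ ^ 2 * (A.axx (meridian X) + A.ayy (meridian X) - A.ax (meridian X) * (cylRadius X)⁻¹)) -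
      X 0 * (cylRadius X)⁻¹ ^ 2 * A.cy (meridian X) := by
  have hc : curl A.U X 0 = fderiv ℝ A.U X (EuclideanSpace.single 1 1) 2 -
      fderiv ℝ A.U X (EuclideanSpace.single 2 1) 1 := by simp [curl]
  rw [hc, fderiv_apply_comp (differentiableAt_U hX),
    fderiv_apply_comp (differentiableAt_U hX), (hasFDerivAt_U_two hX).fderiv,
    (hasFDerivAt_U_one hX).fderiv]
  have hr := cylRadius_ne_zero hX
  have hS := sumSq_ne_zero hX
  have hr2 := cylRadius_sq X
  simp only [_root_.smul_apply, _root_.add_apply, _root_.neg_apply,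
    smul_eq_mul, innerSL_apply_apply, inner_eR_left, PiLp.proj_apply, PiLp.single_apply,
    lay, lax, lc, meridian_apply]
  simp
  field_simp
  rw [← hr2]
  ring

/-- **Second component of the vorticity of the ansatz**:
`(curl U)₁ = X₀ ρ⁻² Δ*a − X₁ ρ⁻² c_z`. -/
theorem curl_U_apply_one :
    curl A.U X 1 = X 0 * (cylRadius X)⁻¹ ^ 2 * (A.axx (meridian X) + A.ayy (meridian X) - A.ax (meridian X) * (cylRadius X)⁻¹) -
      X 1 * (cylRadius X)⁻¹ ^ 2 * A.cy (meridian X) := by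
  have hc : curl A.U X 1 = fderiv ℝ A.U X (EuclideanSpace.single 2 1) 0 -
      fderiv ℝ A.U X (EuclideanSpace.single 0 1) 2 := by simp [curl]
  rw [hc, fderiv_apply_comp (differentiableAt_U hX),
    fderiv_apply_comp (differentiableAt_U hX), (hasFDerivAt_U_two hX).fderiv,
    (hasFDerivAt_U_zero hX).fderiv]
  have hr := cylRadius_ne_zero hX
  have hS := sumSq_ne_zero hX
  have hr2 := cylRadius_sq X
  simp only [_root_.smul_apply, _root_.add_apply, _root_.sub_apply, _root_.neg_apply,
    smul_eq_mul, innerSL_apply_apply, inner_eR_left, PiLp.proj_apply, PiLp.single_apply,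
    lay, lax, lc, meridian_apply]
  simp
  field_simp
  rw [← hr2]
  ring

/-- **Third component of the vorticity of the ansatz**: `(curl U)₂ = c_ρ / ρ`. -/
theorem curl_U_apply_two :
    curl A.U X 2 = A.cx (meridian X) * (cylRadius X)⁻¹ := by
  have hc : curl A.U X 2 = fderiv ℝ A.U X (EuclideanSpace.single 0 1) 1 -
      fderiv ℝ A.U X (EuclideanSpace.single 1 1) 0 := by simp [curl]
  rw [hc, fderiv_apply_comp (differentiableAt_U hX),
    fderiv_apply_comp (differentiableAt_U hX), (hasFDerivAt_U_one hX).fderiv,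
    (hasFDerivAt_U_zero hX).fderiv]
  have hr := cylRadius_ne_zero hX
  have hS := sumSq_ne_zero hX
  have hr2 := cylRadius_sq X
  simp only [_root_.smul_apply, _root_.add_apply, _root_.sub_apply,
    smul_eq_mul, innerSL_apply_apply, inner_eR_left, PiLp.proj_apply, PiLp.single_apply,
    lay, lc, meridian_apply]
  simp
  field_simp
  ring

/-- **Helicity density of the ansatz**: `⟪U, curl U⟫ = ρ⁻²(c Δ*a − a_z c_z − a_ρ c_ρ)`. -/
theorem inner_U_curl_U :
    ⟪A.U X, curl A.U X⟫ = (cylRadius X)⁻¹ ^ 2 *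
      (A.c (meridian X) * (A.axx (meridian X) + A.ayy (meridian X) - A.ax (meridian X) * (cylRadius X)⁻¹) - A.ay (meridian X) * A.cy (meridian X) -
        A.ax (meridian X) * A.cx (meridian X)) := by
  have h : ⟪A.U X, curl A.U X⟫ = A.U X 0 * curl A.U X 0 + A.U X 1 * curl A.U X 1 +
      A.U X 2 * curl A.U X 2 := by
    simp [PiLp.inner_apply, Fin.sum_univ_three, mul_comm]
  rw [h, curl_U_apply_zero hX, curl_U_apply_one hX, curl_U_apply_two hX, U_apply_zero, U_apply_one,
    U_apply_two]
  have hr := cylRadius_ne_zero hX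
  have hS := sumSq_ne_zero hX
  have hr2 := cylRadius_sq X
  simp only [lay, lax, lc, meridian_apply]
  field_simp
  ring

end pointwise

/-! ### Gavrilov's local solution: the two exact identities -/

section Gavrilov

variable {D : ProfileData} {q : ℝ × ℝ}

/-- `|∇α|² = 12x²α − H(α)` on the solution domain (from `α_x = F`, `α_y² = G`,
`G = 12x²α − F² − H`). -/
theorem normSq_grad_alpha (hq : q ∈ D.locDom) :
    D.alphaX q ^ 2 + D.alphaY q ^ 2 = 12 * q.1 ^ 2 * D.alpha q - D.H (D.alpha q) := by
  have hF := ProfileData.gF_alpha hq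
  have hG := ProfileData.gG_alpha hq
  have hGdef : D.gG (q.1, D.alpha q) =
      12 * q.1 ^ 2 * D.alpha q - D.gF (q.1, D.alpha q) ^ 2 - D.H (D.alpha q) := rfl
  rw [hF] at hGdef
  linear_combination -hG + hGdef

/-- The Grad–Shafranov (Bragg–Hawthorne) form of the solution: `Δ*α = α_xx + α_yy − α_x/x =
10x² − H'(α)/2` (Bernoulli head `10α`, swirl `√H(α)`). -/
theorem lapStar_alpha (hq : q ∈ D.locDom) (hq0 : q.1 ≠ 0) :
    D.alphaXX q + D.alphaYY q - D.alphaX q * q.1⁻¹ = 10 * q.1 ^ 2 - D.gH' (D.alpha q) / 2 := by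
  obtain ⟨hxx, -, hyy⟩ := ProfileData.alpha_second_derivs hq
  have hF := ProfileData.gF_alpha hq
  rw [hxx, hyy, ← hF]
  simp only [ProfileData.gFx, ProfileData.gF, ProfileData.gFa, ProfileData.gGa]
  field_simp
  ring

/-- `5H(α) − 3αH'(α) > 0` for small `α > 0` (`H(0) = 0`, `H'(0) = 4`): the sign of the helicity
density of Gavrilov's flow near the core circle. -/
theorem exists_helicityFactor_pos (D : ProfileData) :
    ∃ a₁ : ℝ, 0 < a₁ ∧ ∀ a : ℝ, 0 < a → a < a₁ → 0 < 5 * D.H a - 3 * a * D.gH' a := by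
  -- `H(a) > 3.9 a` near `0⁺`
  have hH0 : HasDerivAt D.H 4 0 := by
    have h := D.hasDerivAt_H 0 (by norm_num)
    simpa [D.ψ_zero] using h
  rw [hasDerivAt_iff_tendsto_slope] at hH0
  have hev : ∀ᶠ a in 𝓝[≠] (0 : ℝ), (39 / 10 : ℝ) < slope D.H 0 a :=
    hH0.eventually (lt_mem_nhds (by norm_num))
  rw [eventually_nhdsWithin_iff, Metric.eventually_nhds_iff] at hev
  obtain ⟨ε, hε, hball⟩ := hev
  -- `H'(a) < 4.1` near `0`
  have hψc : ContinuousAt D.ψ 0 :=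
    D.contDiffOn_ψ.continuousOn.continuousAt (Metric.isOpen_ball.mem_nhds (by simp))
  have hχc : ContinuousAt D.χ 0 :=
    D.contDiffOn_χ.continuousOn.continuousAt (Metric.isOpen_ball.mem_nhds (by simp))
  have hgc : ContinuousAt (fun a => D.gH' a) 0 := by
    have : ContinuousAt (fun a => 4 * D.ψ a + 24 * a * D.χ a) 0 :=
      (continuousAt_const.mul hψc).add ((continuousAt_const.mul continuousAt_id).mul hχc)
    exact this
  have hev2 : ∀ᶠ a in 𝓝 (0 : ℝ), D.gH' a < 41 / 10 :=
    hgc.eventually (gt_mem_nhds (by simp; norm_num))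
  rw [Metric.eventually_nhds_iff] at hev2
  obtain ⟨ε', hε', hball'⟩ := hev2
  refine ⟨min ε ε', lt_min hε hε', fun a ha0 ha => ?_⟩
  have haε : a < ε := lt_of_lt_of_le ha (min_le_left _ _)
  have haε' : a < ε' := lt_of_lt_of_le ha (min_le_right _ _)
  have hs := hball (y := a) (by rwa [dist_zero_right, Real.norm_eq_abs, abs_of_pos ha0]) ha0.ne'
  rw [slope_def_field, D.H_zero, sub_zero, sub_zero, lt_div_iff₀ ha0] at hs
  have hg := hball' (y := a) (by rwa [dist_zero_right, Real.norm_eq_abs, abs_of_pos ha0])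
  nlinarith

/-- The rescaling at radius `1` is the identity. -/
@[simp] theorem rescale_one (q : ℝ × ℝ) : rescale 1 q = q := by
  simp [rescale]

end Gavrilov

/-! ### The ansatz at radius `1`: field values and the helicity density -/

section RadiusOne

variable {D : ProfileData} {a₀ : ℝ} (hH : ∀ a : ℝ, 0 < a → a < a₀ → 0 < D.H a)

/-- Membership in the tube of the radius-one ansatz. -/
theorem mem_tube_A1_iff {X : EuclideanSpace ℝ (Fin 3)} :
    X ∈ (D.ansatz one_pos hH).tube ↔ meridian X ∈ D.merDom a₀ ∧ meridian X ≠ (1, 0) := by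
  show rescale 1 (meridian X) ∈ D.merDom a₀ \ {((1 : ℝ), (0 : ℝ))} ↔ _
  rw [rescale_one, mem_sdiff_singleton]

/-- Field of the radius-one ansatz: `a = α`. -/
@[simp] theorem A1_a (q : ℝ × ℝ) : (D.ansatz one_pos hH).a q = D.alpha q := by simp [ProfileData.ansatz]

/-- Field of the radius-one ansatz: `a_ρ = α_x`. -/
@[simp] theorem A1_ax (q : ℝ × ℝ) : (D.ansatz one_pos hH).ax q = D.alphaX q := by simp [ProfileData.ansatz]

/-- Field of the radius-one ansatz: `a_z = α_y`. -/
@[simp] theorem A1_ay (q : ℝ × ℝ) : (D.ansatz one_pos hH).ay q = D.alphaY q := by simp [ProfileData.ansatz]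

/-- Field of the radius-one ansatz: `a_ρρ = α_xx`. -/
@[simp] theorem A1_axx (q : ℝ × ℝ) : (D.ansatz one_pos hH).axx q = D.alphaXX q := by
  simp [ProfileData.ansatz]

/-- Field of the radius-one ansatz: `a_ρz = α_xy`. -/
@[simp] theorem A1_axy (q : ℝ × ℝ) : (D.ansatz one_pos hH).axy q = D.alphaXY q := by
  simp [ProfileData.ansatz]

/-- Field of the radius-one ansatz: `a_zz = α_yy`. -/
@[simp] theorem A1_ayy (q : ℝ × ℝ) : (D.ansatz one_pos hH).ayy q = D.alphaYY q := by
  simp [ProfileData.ansatz]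

/-- Field of the radius-one ansatz: the swirl `c = √H(α)`. -/
@[simp] theorem A1_c (q : ℝ × ℝ) : (D.ansatz one_pos hH).c q = Real.sqrt (D.H (D.alpha q)) := by
  simp [ProfileData.ansatz]

/-- Field of the radius-one ansatz: `c_ρ = H'(α) α_x / (2√H(α))`. -/
@[simp] theorem A1_cx (q : ℝ × ℝ) : (D.ansatz one_pos hH).cx q =
    D.gH' (D.alpha q) / (2 * Real.sqrt (D.H (D.alpha q))) * D.alphaX q := by
  simp [ProfileData.ansatz]

/-- Field of the radius-one ansatz: `c_z = H'(α) α_y / (2√H(α))`. -/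
@[simp] theorem A1_cy (q : ℝ × ℝ) : (D.ansatz one_pos hH).cy q =
    D.gH' (D.alpha q) / (2 * Real.sqrt (D.H (D.alpha q))) * D.alphaY q := by
  simp [ProfileData.ansatz]

variable {hH} {X : EuclideanSpace ℝ (Fin 3)}

/-- On the tube of the radius-one ansatz: the meridian point is in the solution domain, off the
axis, `0 < α < a₀` and `H(α) > 0`. -/
theorem tube_A1_facts (hX : X ∈ (D.ansatz one_pos hH).tube) :
    meridian X ∈ D.locDom ∧ 0 < cylRadius X ∧ 0 < D.alpha (meridian X) ∧
      D.alpha (meridian X) < a₀ ∧ 0 < D.H (D.alpha (meridian X)) := by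
  obtain ⟨hm, hne⟩ := (mem_tube_A1_iff hH).1 hX
  have hpos : 0 < D.alpha (meridian X) := ProfileData.alpha_pos hm.1.1 hne
  exact ⟨hm.1.1, hm.2, hpos, hm.1.2, hH _ hpos hm.1.2⟩

/-- **Helicity density of Gavrilov's flow**: on the tube of the radius-one ansatz,
`⟪U, curl U⟫ = 2(5H(α) − 3αH'(α))/√H(α)` with `α = α(ρ, z)`. -/
theorem inner_U_curl_U_A1 (hX : X ∈ (D.ansatz one_pos hH).tube) :
    ⟪(D.ansatz one_pos hH).U X, curl (D.ansatz one_pos hH).U X⟫ =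
      2 * (5 * D.H (D.alpha (meridian X)) - 3 * D.alpha (meridian X) * D.gH' (D.alpha (meridian X))) /
        Real.sqrt (D.H (D.alpha (meridian X))) := by
  obtain ⟨hm, hr, -, -, hHpos⟩ := tube_A1_facts hX
  have hr' : cylRadius X ≠ 0 := hr.ne'
  have hq1 : (meridian X).1 = cylRadius X := rfl
  have hN := normSq_grad_alpha hm
  have hL := lapStar_alpha hm (by rw [hq1]; exact hr')
  rw [hq1] at hN hL
  set s := Real.sqrt (D.H (D.alpha (meridian X))) with hs
  have hs0 : 0 < s := Real.sqrt_pos.2 hHpos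
  have hs2 : s ^ 2 = D.H (D.alpha (meridian X)) := Real.sq_sqrt hHpos.le
  rw [← hs2] at hN
  rw [inner_U_curl_U hX]
  simp only [A1_c, A1_ax, A1_ay, A1_axx, A1_ayy, A1_cx, A1_cy]
  rw [← hs, hL, ← hs2]
  set g := D.gH' (D.alpha (meridian X)) with hg
  set ρ := cylRadius X with hρ
  have key : s * (10 * ρ ^ 2 - g / 2) - D.alphaY (meridian X) * (g / (2 * s) * D.alphaY (meridian X)) -
      D.alphaX (meridian X) * (g / (2 * s) * D.alphaX (meridian X)) =
      2 * ρ ^ 2 * (5 * s ^ 2 - 3 * D.alpha (meridian X) * g) / s := by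
    field_simp
    linear_combination (-g) * hN
  rw [key]
  field_simp

end RadiusOne

end Summit.NavierStokesRegularity.NavierStokesRegularity.Theorems.ChiralEddyExists
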